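import Summits.RiemannHypothesis.RiemannHypothesis.Theorems.GroundBartaPolarPerronFrobeniusRobustThreshold
import HarnessLib

/-!
# RH from Φ-WEIGHTED SIGN DOMINANCE of a ground state, cofinally (route `RiemannHypothesis/GroundBarta`,
crux `PolarPerronFrobenius` stmt-RiemannHypothesis-18390; the MASS FORM of the robust crux — RH-free
deciding theorems; restatement candidate)

For a ground state `u` of the full windowed Weil form at `a` put `v = 𝟙_{(-a,a)} Re u`,
`v⁺ = max(v,0)`, `v⁻ = max(-v,0)`, `Φ = weilThetaPhi` (Riemann's kernel, `Φ̂ = ξ`).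

* `riemannHypothesis_of_cofinal_signDominantGroundState` — **if beyond every height some window `a`
  carries a ground state `u` with `Im u = 0` a.e. on `(-a,a)`, `∫ v⁻Φ ≤ (1/3) ∫ v⁺Φ` and
  `∫ v⁺Φ ≥ exp(−e^{a})`, then the Riemann Hypothesis holds.**
* `riemannHypothesis_of_signDominantPolarPerronFrobenius` — the route-shaped form: the same asked
  only at windows where the even sector carries the bottom (`EW a`), together with
  `EvenWinsBeyondArch`, implies RH.
Proof: `√∫(v⁻)² ≤ ‖u‖₂ = 1` and `∫ v⁻ ≤ √(2a)` (`signDom_negPart_mass`), so the leakage bound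
`R_a(v⁻) ≤ Π_a√(2a) + Φ(a)(4 + 8√(2a)) ≤ (1/3) e(a) exp(−e^{a})` beyond the threshold height `a₁` of
`thr_threshold_eventually`; this is hypothesis (H2) of the robust floor
(`riemannHypothesis_of_cofinal_robustGroundState`, file `…RobustFloor`).  Compared with the crux as
filed (`PolarPerronFrobenius`: SOME ground state is real and `≥ 0` a.e. on the open window) the
sign condition is relaxed from pointwise to a 3 : 1 dominance of `Φ`-weighted masses — a bulk
condition blind to the edge layers — at the price of the (super-exponentially mild) non-degeneracy
`∫ v⁺Φ ≥ exp(−e^{a})`.  RH-free; Mathlib + landed tree files; no definitions.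
References: Bombieri 2000 §4; Barta 1937 (López-Gómez p.175); Yoshida 1992 (odd criterion).
-/

set_option linter.dupNamespace false

noncomputable section

open Set MeasureTheory Filter Complex
open scoped Real Topology ComplexConjugate ArithmeticFunction.vonMangoldt

namespace Summit.RiemannHypothesis.RiemannHypothesis.Theorems.GroundBartaFloor

open Literature.NumberTheory.LFunctions
open Summit.RiemannHypothesis.RiemannHypothesis.Theorems.GroundStatesConvergeToXi

/-! ## The negative part of a ground state has `L²` mass `≤ 1` and `L¹` mass `≤ √(2a)` -/

/-- For a ground state `u` at `a > 0` and `v⁻ = max(-𝟙_{(-a,a)}Re u, 0)`: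
`0 ≤ ∫ v⁻`, `∫ v⁻ ≤ √(2a)` (Cauchy–Schwarz on the window) and `√(∫ (v⁻)²) ≤ 1` (`|v⁻| ≤ |u|`,
`∫|u|² = 1`). [folklore] -/
theorem signDom_negPart_mass {a : ℝ} (ha : 0 < a) {u : ℝ → ℂ} (hu : IsWeilGroundState a u) :
    0 ≤ (∫ t, max (-(Ioo (-a) a).indicator (fun t => (u t).re) t) 0) ∧
      (∫ t, max (-(Ioo (-a) a).indicator (fun t => (u t).re) t) 0) ≤ Real.sqrt (2 * a) ∧
      Real.sqrt (∫ t, max (-(Ioo (-a) a).indicator (fun t => (u t).re) t) 0 ^ 2) ≤ 1 := by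
  obtain ⟨hu2, -⟩ := id hu
  set v : ℝ → ℝ := (Ioo (-a) a).indicator fun t => (u t).re with hv
  set vm : ℝ → ℝ := fun t => max (-v t) 0 with hvm
  have hvm0 : ∀ t, 0 ≤ vm t := fun t => le_max_right _ _
  have hvs : ∀ t, t ∉ Icc (-a) a → v t = 0 := fun t ht => by
    simp only [hv, indicator_of_notMem (fun h => ht (Ioo_subset_Icc_self h))]
  have hvms : ∀ t, t ∉ Icc (-a) a → vm t = 0 := fun t ht => by
    simp only [hvm, hvs t ht, neg_zero, max_self]
  have hv_le : ∀ t, |v t| ≤ ‖u t‖ := fun t => by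
    by_cases ht : t ∈ Ioo (-a) a
    · simp only [hv, indicator_of_mem ht]; exact Complex.abs_re_le_norm _
    · simp only [hv, indicator_of_notMem ht, abs_zero]; exact norm_nonneg _
  have hvm_le : ∀ t, |vm t| ≤ ‖u t‖ := fun t => by
    rw [abs_of_nonneg (hvm0 t)]
    exact (max_le (neg_le_abs _) (abs_nonneg _)).trans (hv_le t)
  have hv_meas : AEStronglyMeasurable v volume :=
    (Complex.continuous_re.comp_aestronglyMeasurable hu2.1).indicator measurableSet_Ioo
  have hvm_meas : AEStronglyMeasurable vm volume := hv_meas.neg.sup aestronglyMeasurable_const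
  have hvm_L2 : MemLp vm 2 :=
    MemLp.of_le hu2 hvm_meas (Eventually.of_forall fun t => by
      rw [Real.norm_eq_abs]; exact hvm_le t)
  -- `∫ (v⁻)² ≤ ∫ |u|² = 1`
  have hsq_int : Integrable fun t => vm t ^ 2 := (memLp_two_iff_integrable_sq hvm_meas).1 hvm_L2
  have husq_int : Integrable fun t => ‖u t‖ ^ 2 := (memLp_two_iff_integrable_sq_norm hu2.1).1 hu2
  have hW₂ : ∫ t, vm t ^ 2 ≤ 1 := by
    rw [← hu.integral_norm_sq]
    refine integral_mono hsq_int husq_int fun t => ?_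
    have h := hvm_le t
    rw [abs_of_nonneg (hvm0 t)] at h
    exact pow_le_pow_left₀ (hvm0 t) h 2
  have hW₂0 : 0 ≤ ∫ t, vm t ^ 2 := integral_nonneg fun t => sq_nonneg _
  have hsqrt : Real.sqrt (∫ t, vm t ^ 2) ≤ 1 := by
    rw [show (1 : ℝ) = Real.sqrt 1 by simp]; exact Real.sqrt_le_sqrt hW₂
  -- `∫ v⁻ ≤ √(2a) √(∫ (v⁻)²) ≤ √(2a)`
  have hW₁ : ∫ t, vm t ≤ Real.sqrt (2 * a) := by
    have hcs := leakNeg_integral_indicator_mul_le (c := -a) (t := 2 * a) hvm_L2 hvm0 (by linarith)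
    have e : (fun t => (Icc (-a) (-a + 2 * a)).indicator (fun _ => (1 : ℝ)) t * vm t) = vm := by
      funext t
      by_cases ht : t ∈ Icc (-a) a
      · have ht' : t ∈ Icc (-a) (-a + 2 * a) := by rw [show -a + 2 * a = a by ring]; exact ht
        rw [indicator_of_mem ht', one_mul]
      · rw [hvms t ht, mul_zero]
    rw [e] at hcs
    exact hcs.trans (mul_le_of_le_one_right (Real.sqrt_nonneg _) hsqrt)
  exact ⟨integral_nonneg hvm0, hW₁, hsqrt⟩

/-! ## Deciding theorems in mass form -/

/-- **RH from Φ-weighted sign dominance, cofinally (no parity input).**  If beyond every height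
there is a window `a` carrying a ground state `u` of the full windowed Weil form with `Im u = 0`
a.e. on `(-a,a)`, `∫ v⁻Φ ≤ (1/3)∫ v⁺Φ` and `∫ v⁺Φ ≥ exp(−e^{a})` (`v = 𝟙_{(-a,a)}Re u`), then the
Riemann Hypothesis holds. [cite: Bombieri2000Weil, §4; Yoshida1992HermitianForms, Prop. 1(1)] -/
theorem riemannHypothesis_of_cofinal_signDominantGroundState
    (hDom : ∀ A : ℝ, ∃ a : ℝ, A ≤ a ∧ ∃ u : ℝ → ℂ, IsWeilGroundState a u ∧
      (∀ᵐ t : ℝ, t ∈ Ioo (-a) a → (u t).im = 0) ∧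
      (∫ t, max (-(Ioo (-a) a).indicator (fun t => (u t).re) t) 0 * weilThetaPhi t) ≤
        (1 / 3) * (∫ t, max ((Ioo (-a) a).indicator (fun t => (u t).re) t) 0 * weilThetaPhi t) ∧
      Real.exp (-Real.exp a) ≤
        (∫ t, max ((Ioo (-a) a).indicator (fun t => (u t).re) t) 0 * weilThetaPhi t)) :
    RiemannHypothesis := by
  obtain ⟨a₁, ha₁⟩ := thr_threshold_eventually
  refine riemannHypothesis_of_cofinal_robustGroundState fun A => ?_
  obtain ⟨a, ha, u, hu, hreal, hneg, hpos⟩ := hDom (max (max A a₁) 1)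
  have haA : A ≤ a := le_trans (le_trans (le_max_left _ _) (le_max_left _ _)) ha
  have haa₁ : a₁ ≤ a := le_trans (le_trans (le_max_right _ _) (le_max_left _ _)) ha
  have ha0 : 0 < a := one_pos.trans_le ((le_max_right _ _).trans ha)
  refine ⟨a, haA, u, hu, hreal, hneg, ?_⟩
  obtain ⟨hm0, hm1, hm2⟩ := signDom_negPart_mass ha0 hu
  set N₁ : ℝ := ∫ t, max (-(Ioo (-a) a).indicator (fun t => (u t).re) t) 0 with hN₁
  set W₂ : ℝ := ∫ t, max (-(Ioo (-a) a).indicator (fun t => (u t).re) t) 0 ^ 2 with hW₂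
  set P : ℝ := ∫ t, max ((Ioo (-a) a).indicator (fun t => (u t).re) t) 0 * weilThetaPhi t with hP
  set PiA : ℝ := 2 * ∑' n : ℕ, (Λ n : ℝ) / Real.sqrt n * weilThetaPhi (max a (Real.log n - a))
    with hPiA
  have hthr : 3 * (PiA * Real.sqrt (2 * a) + weilThetaPhi a * (4 + 8 * Real.sqrt (2 * a))) ≤
      groundBartaRate a * Real.exp (-Real.exp a) := ha₁ a haa₁
  have hPi0 : 0 ≤ PiA := leakNeg_primeMajorant_nonneg a
  have hΦa := weilThetaPhi_pos a
  have he0 := groundBartaRate_nonneg a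
  have hs0 : 0 ≤ Real.sqrt W₂ := Real.sqrt_nonneg _
  -- `R ≤ M`
  have hRM : PiA * N₁ + weilThetaPhi a * (4 * Real.sqrt W₂ + 8 * N₁) ≤
      PiA * Real.sqrt (2 * a) + weilThetaPhi a * (4 + 8 * Real.sqrt (2 * a)) := by
    have h1 : PiA * N₁ ≤ PiA * Real.sqrt (2 * a) := mul_le_mul_of_nonneg_left hm1 hPi0
    have h2 : 4 * Real.sqrt W₂ + 8 * N₁ ≤ 4 + 8 * Real.sqrt (2 * a) := by linarith
    nlinarith
  -- `3M ≤ e(a) exp(-e^a) ≤ e(a) P`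
  have hMP : groundBartaRate a * Real.exp (-Real.exp a) ≤ groundBartaRate a * P :=
    mul_le_mul_of_nonneg_left hpos he0
  linarith

/-- **The mass form of the robust crux closes the route.**  If beyond every height there is a
window `a` at which, WHENEVER the even sector carries the bottom (`EW a`), some ground state is
Φ-sign-dominant (`Im u = 0` a.e. on the window, `∫ v⁻Φ ≤ (1/3)∫ v⁺Φ`, `∫ v⁺Φ ≥ exp(−e^{a})`),
then `EvenWinsBeyondArch` implies the Riemann Hypothesis.
[cite: Bombieri2000Weil, §4; Yoshida1992HermitianForms, Prop. 1(1)] -/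
theorem riemannHypothesis_of_signDominantPolarPerronFrobenius
    (hDomPF : ∀ A : ℝ, ∃ a : ℝ, A ≤ a ∧
      ((∀ o : ℝ → ℂ, IsWeilTest o → tsupport o ⊆ Icc (-a) a → (∀ t, o (-t) = -o t) →
          ∫ t, ‖o t‖ ^ 2 = (1 : ℝ) → ∀ δ : ℝ, 0 < δ → ∃ w : ℝ → ℂ, IsWeilTest w ∧
            tsupport w ⊆ Icc (-a) a ∧ (∀ t, w (-t) = w t) ∧ ∫ t, ‖w t‖ ^ 2 = (1 : ℝ) ∧
            (weilQuadratic w).re ≤ (weilQuadratic o).re + δ) →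
        ∃ u : ℝ → ℂ, IsWeilGroundState a u ∧ (∀ᵐ t : ℝ, t ∈ Ioo (-a) a → (u t).im = 0) ∧
        (∫ t, max (-(Ioo (-a) a).indicator (fun t => (u t).re) t) 0 * weilThetaPhi t) ≤
          (1 / 3) * (∫ t, max ((Ioo (-a) a).indicator (fun t => (u t).re) t) 0 * weilThetaPhi t) ∧
        Real.exp (-Real.exp a) ≤
          (∫ t, max ((Ioo (-a) a).indicator (fun t => (u t).re) t) 0 * weilThetaPhi t)))
    (hEven : Summit.RiemannHypothesis.RiemannHypothesis.Theses.GroundBarta.EvenWinsBeyondArch) :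
    RiemannHypothesis := by
  have hEW : ∀ a : ℝ, Real.log 2 / 2 < a → ∀ o : ℝ → ℂ, IsWeilTest o →
      tsupport o ⊆ Icc (-a) a → (∀ t, o (-t) = -o t) → ∫ t, ‖o t‖ ^ 2 = (1 : ℝ) → ∀ δ : ℝ, 0 < δ →
      ∃ w : ℝ → ℂ, IsWeilTest w ∧ tsupport w ⊆ Icc (-a) a ∧ (∀ t, w (-t) = w t) ∧
        ∫ t, ‖w t‖ ^ 2 = (1 : ℝ) ∧ (weilQuadratic w).re ≤ (weilQuadratic o).re + δ := hEven
  refine riemannHypothesis_of_cofinal_signDominantGroundState fun A => ?_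
  obtain ⟨a, ha, hgood⟩ := hDomPF (max A 1)
  have haA : A ≤ a := le_trans (le_max_left _ _) ha
  have ha1 : (1 : ℝ) ≤ a := le_trans (le_max_right _ _) ha
  have hlog : Real.log 2 / 2 < a := by
    have h2 : Real.log 2 < 0.6931471808 := Real.log_two_lt_d9
    linarith
  exact ⟨a, haA, hgood (hEW a hlog)⟩

end Summit.RiemannHypothesis.RiemannHypothesis.Theorems.GroundBartaFloor

end
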